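/-
Copyright (c) 2026 the pub-hodgecm-mathlib formalisation cell (harness21).  Prover seat hodgecm-mathlib-F0P3b-p01 (g26); E1 keeper ∕ dealer F0P3a-p03 (g30)
«= VERDICT + CUT (A)+(B)» 2026-09-03T04:01:05Z on CENSUS-R64 v1 b3df5796 (E1 BRICK LEDGER row 64-B).
-/
import Summits.HodgeConjecture.HodgeConjecture.Theorems.F0P3U3PrincipalSeriesLettersHold   -- ★ N2 `u3PrincipalSeriesConstituentEmbeds_holds`, ★ N3 `u3PrincipalSeriesLengthLeTwo_holds`; brings ★ N1 `U3PrincipalSeriesJacquetFiltration_holds`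
import Summits.HodgeConjecture.HodgeConjecture.Theorems.F0P3UnipotentLimitCompactOpen      -- ★ `isLimitOfCompactOpen_cmUnipotentU` (`hNlim`); brings ★ `deltaChar_cmBorel_eq_one` (`hδ`)
import Summits.HodgeConjecture.HodgeConjecture.Theorems.F0P3XiUnramNonsplitInstance        -- ★ `isAdmissible_cmPrincipalSeries`; brings `Gqs`
import Summits.HodgeConjecture.HodgeConjecture.Theorems.F0P3cStCharTSWeylFixedIffNormTrivial -- ★ (LH6 lineage, over ★ p852743 PS-IRRED-REGULAR) `cmWeylTorusCharPair_eq_of_apply_fixed_eq_one` (`wχ = χ` when `χ₁|_{F×} = 1`)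
import Literature.NumberTheory.Automorphic.JacquetLengthTwoLabelsSame                      -- ★ row 64-A (this seat) p853521: `IrrClass.labelledPair_exists_of_line_abs_same`
import HarnessLib

/-!
# F0 · P3c · «StCharTS» K4′ column — E1 row 64-B «THE L.D.S. LABELLED PAIR»: in case (3) BOTH members of `Π(θ) = JH(i_B(θ̃))` have normalised Jacquet module
# the ONE character `θ̃`, given two distinct constituents (rung 0's `hLdsTwo` ⟺ «LDS-REDUCIBLE-TWO»)
# [Rogawski1990, §12.2 (3) pp. 173–174; Keys1984 §7 Thm. (1) p. 126; Casselman1995 §7.1]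

Cell `pub/hodgecm-mathlib`, crux H413 = `stmt-HodgeConjecture-24833` (`--supports` lane, `--as helper`-class: THEOREMS ONLY, no definition ∕ instance ∕ notation ∕
named fact ∕ `sorry`), route HCCMUnconditional.  E1 BRICK LEDGER (keeper F0P3a-p03 (g30)) row 64-B, the case-(3) twin of ★ `F0P3KeysLabelledPair.labelledPair_of_reducible`
(case (2)).  Namespace `Summit.HodgeConjecture.HodgeConjecture.Cruxes.H413.F0P3cStCharTSLdsLabelledPair`.

THE MATHEMATICS.  `G = Gqs L v = U(Φ₃)(L⁺_v)`, `v` non-split in the CM field `L` (`hns`), `χ = (χ₁, χ₂)` a continuous character of the diagonal torus in the PAIR currency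
(★ `cmTorusCharPair`), `i_G(χ)` = ★ `cmPrincipalSeries L 3 v χ`.  CASE (3) of [Rogawski1990, §12.2 p. 173]: `χ₁ ≠ 1` with `χ₁|_{F_v^×} ≡ 1` (`θ = χ` «semi-regular»,
`χ = θ̃`); then (Keys) the unitary `i_G(χ)` is the direct sum of two inequivalent irreducible constituents, the l.d.s. `L`-packet `Π(θ) = JH(i_B(θ̃))`.  The tree does
NOT prove Keys' reducibility (R1) or the inequivalence (R2): they are RUNG 0's named input `hLdsTwo` ⟺ «LDS-REDUCIBLE-TWO» `∃ c₁ ≠ c₂` constituents (★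
`F0P3cStCharTSLdsTwoOfTwo.two_constituents_iff_ldsTwo`), taken here as the binder `htwo`.  WHAT THIS FILE PROVES (everything else ★): at such `χ`,
* `wχ = χ` is ★ `F0P3cStCharTSWeylFixedIffNormTrivial.cmWeylTorusCharPair_eq_of_apply_fixed_eq_one` (`w(χ₁, χ₂) = (χ̄₁⁻¹, χ₂)` and `χ₁(σ a)⁻¹ = χ₁(a)` because `σ(a)·a`
  is `σ`-fixed): the stable line of `r_B(i_G χ)` (character `wχ`, ★ N1 `U3PrincipalSeriesJacquetFiltration`) and its quotient (character `χ`) carry THE SAME character —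
  `r_B(i_G χ)` is a self-extension of `χ`, and the labelled-pair package ★ `JacquetLengthTwoLabels{Emb,Abs}` (`θ₁ ≠ θ₂`) is vacuous; whence ★ row 64-A `JacquetLengthTwoLabelsSame`.
* **THE L.D.S. LABELLED PAIR** (`ldsLabelledPair_of_two_constituents`, the one theorem of this file): GIVEN `htwo`, there are classes `πs ≠ πn` with `JH(i_G χ) = {πn, πs}` EXACTLY, and representatives
  with `r_B(πs) ≅ 𝟙 ⊗ χ` and `r_B(πn) ≅ 𝟙 ⊗ wχ` (`= 𝟙 ⊗ χ`; the two letters are kept as they come out of ★ N1 so that E1 row 63's realisation package ★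
  `exists_realisation_schurPair … {θ₁ θ₂} (hne) (hJH) (hs) (hn)` is fed VERBATIM at `θ₁ := wχ`, `θ₂ := χ`) — ONE call of ★ 64-A `IrrClass.labelledPair_exists_of_line_abs_same`
  over ★ N1 (line data), ★ N2 (every constituent embeds into `i_G(χ)` or `i_G(wχ)`), ★ N3 (no 3-chains), ★ `isLimitOfCompactOpen_cmUnipotentU`, ★ `deltaChar_cmBorel_eq_one`,
  ★ `isAdmissible_cmPrincipalSeries`, in the `cases … with | intro` discipline of ★ `F0P3KeysLabelledPair` (its ELABORATION NOTE: no `obtain`∕`rw … at` on N1's def-terms at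
  the CM carrier; `Equiv.refl _` confines the unfolding `cmPrincipalSeries = i_B^G χ` to one place).
CONSUMER: the K4′ (d1′)+(b′) rider = E1 row 63's ★ `Literature.NumberTheory.Automorphic.IrrClass.exists_realisation_schurPair` at `θ₂ := cmTorusCharPair L v χ₁ χ₂` fed by §2
(`Theorems/F0P3cStCharTSLdsRealisation.lean`, next).  HONEST LABEL: count-neutral; the only non-★ binder is `htwo` = rung 0's (R1)+(R2) [Keys1984 §7 Thm. (1); Rogawski1990
p. 174] — PRINT of record, carried not asserted; h413 OPEN; HC_CM is proved only modulo the 7 printed citations (2 remaining named inputs hLiu418 = stmt-HodgeConjecture-24832,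
h413 = stmt-HodgeConjecture-24833) until rung 0 closes.

## References
* [Rogawski1990] J. D. Rogawski, *Automorphic Representations of Unitary Groups in Three Variables*, Ann. of Math. Stud. 123 (1990), §12.1 p. 171 (`w(χ₁, χ₂) = (χ̄₁⁻¹, χ₂)`),
  §12.2 p. 173 ll. 8–12 and (3) pp. 173–174 (the l.d.s. `L`-packets `Π(θ)`).
* [Keys1984] D. Keys, *Principal series representations of special unitary groups over local fields*, Compositio Math. 51 (1984), §7 Thm. p. 126.
* [Casselman1995] W. Casselman, *Introduction to the theory of admissible representations of p-adic reductive groups* (draft 1995), L. 7.1.1 (a), Cor. 7.1.2, Cor. 6.3.9 (b),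
  Prop. 6.4.1, Thm 3.2.4.
* [BernsteinZelevinsky1977] I. N. Bernstein, A. V. Zelevinsky, *Induced representations of reductive p-adic groups I*, Ann. Sci. ÉNS 10 (1977), Prop. 1.9, §2.3, Cor. 2.13 (c).
-/

set_option autoImplicit false
-- the mandated namespace has the single-problem summit's repeated segment (`HodgeConjecture.HodgeConjecture`)
set_option linter.dupNamespace false

noncomputable section

open NumberField IsDedekindDomain
open scoped Matrix
open Literature.NumberTheory.Rogawski1990 Literature.NumberTheory.Automorphic Literature.NumberTheory.Automorphic.UnitaryGroup
open Summit.HodgeConjecture.HodgeConjecture.Cruxes.H413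

namespace Summit.HodgeConjecture.HodgeConjecture.Cruxes.H413.F0P3cStCharTSLdsLabelledPair

variable (L : Type) [Field L] [NumberField L] [IsCMField L] (v : HeightOneSpectrum (𝓞 ↥(maximalRealSubfield L)))

/-! ## The l.d.s. labelled pair -/

set_option synthInstance.maxHeartbeats 400000 in
set_option maxHeartbeats 20000000 in  -- definitional bookkeeping between the cited statements' elaborations of the CM carrier (★ `F0P3KeysLabelledPair` ELABORATION NOTE)
/-- **E1 ROW 64-B — THE L.D.S. LABELLED PAIR.**  At a finite place `v` of `L⁺` non-split in `L`, for continuous `χ₁, χ₂` with `χ₁` trivial on the `σ`-fixed units (case (3),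
`wχ = χ`, ★ `cmWeylTorusCharPair_eq_of_apply_fixed_eq_one`): IF `i_G(χ₁, χ₂)` has two distinct constituents (`htwo` — rung 0's named input `hLdsTwo` ⟺ «LDS-REDUCIBLE-TWO», i.e. Keys' reducibility + inequivalence, PRINT,
carried), THEN there are classes `πs ≠ πn` such that the constituents of `i_G(χ₁, χ₂)` are EXACTLY `πn, πs`, a representative of `πs` has normalised Jacquet module
`≅ 𝟙 ⊗ χ` and a representative of `πn` has normalised Jacquet module `≅ 𝟙 ⊗ wχ` (`= 𝟙 ⊗ χ`) — both ONE-dimensional: the two members of the l.d.s. packet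
`Π(θ) = JH(i_B(θ̃))` both have `r_B ≅ θ̃`.  ONE call of ★ `IrrClass.labelledPair_exists_of_line_abs_same` fed by ★ N1 (line `wχ`, quotient `χ`, `dim = 2`), ★ N2, ★ N3,
`heq :=` ★ `cmWeylTorusCharPair_eq_of_apply_fixed_eq_one`; output = E1 row 63's `exists_realisation_schurPair` inputs `(hne) (hJH) (hs) (hn)` at `θ₁ := wχ`, `θ₂ := χ`.
[cite: Rogawski1990, §12.2 (3) pp. 173–174] [cite: Keys1984, §7 Thm. p. 126] [cite: Casselman1995, L. 7.1.1 (a), Cor. 7.1.2, Cor. 6.3.9 (b), Prop. 6.4.1, Thm 3.2.4]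
[cite: BernsteinZelevinsky1977, Prop. 1.9, Cor. 2.13 (c)] -/
theorem ldsLabelledPair_of_two_constituents (hns : ∀ w : PlacesOver L v, IsCMField.complexConj L • w.1 = w.1)
    (χ₁ : (LocalRing L v)ˣ →* ℂˣ) (χ₂ : ↥(normOneUnits (conjLocal L (IsCMField.complexConj L) v)) →* ℂˣ)
    (hc1 : Continuous (fun x => ((χ₁ x : ℂˣ) : ℂ))) (hc2 : Continuous (fun x => ((χ₂ x : ℂˣ) : ℂ)))
    (htriv : ∀ a : (LocalRing L v)ˣ, (conjLocal L (IsCMField.complexConj L) v) (a : LocalRing L v) = a → χ₁ a = 1)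
    (htwo : ∃ c₁ c₂ : IrrClass (Gqs L v), c₁ ≠ c₂ ∧ c₁.IsConstituentOf (cmPrincipalSeries L 3 v (cmTorusCharPair L v χ₁ χ₂)) ∧
      c₂.IsConstituentOf (cmPrincipalSeries L 3 v (cmTorusCharPair L v χ₁ χ₂))) :
    ∃ πs πn : IrrClass (Gqs L v), πs ≠ πn ∧
      (∀ c : IrrClass (Gqs L v), c.IsConstituentOf (cmPrincipalSeries L 3 v (cmTorusCharPair L v χ₁ χ₂)) ↔ (c = πn ∨ c = πs)) ∧
      (haveI := locallyCompactSpace_cmBorelU L 3 v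
       ∃ r : SmoothIrrep (Gqs L v), IrrClass.mk r = πs ∧
        Nonempty ((r.ρ.normalizedJacquet (cmBorelTriple L 3 v)).Equiv
          ((Representation.trivial ℂ ↥(torusU (conjLocal L (IsCMField.complexConj L) v) (cmLocalForm L 3 v)) ℂ).twist (cmTorusCharPair L v χ₁ χ₂)))) ∧
      (haveI := locallyCompactSpace_cmBorelU L 3 v
       ∃ r : SmoothIrrep (Gqs L v), IrrClass.mk r = πn ∧
        Nonempty ((r.ρ.normalizedJacquet (cmBorelTriple L 3 v)).Equiv
          ((Representation.trivial ℂ ↥(torusU (conjLocal L (IsCMField.complexConj L) v) (cmLocalForm L 3 v)) ℂ).twist (cmWeylTorusCharPair L v χ₁ χ₂)))) := by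
  haveI := locallyCompactSpace_cmBorelU L 3 v
  -- the letters at `χ = (χ₁, χ₂)`: N3 (no 3-chains), N2 (embedding property), N1 (line data), all ★
  have hlen := F0P3U3PrincipalSeriesLettersHold.u3PrincipalSeriesLengthLeTwo_holds L v hns χ₁ χ₂ hc1 hc2
  have hemb := F0P3U3PrincipalSeriesLettersHold.u3PrincipalSeriesConstituentEmbeds_holds L v hns χ₁ χ₂ hc1 hc2
  have h1 := F0P3U3PrincipalSeriesJacquetFiltrationHolds.U3PrincipalSeriesJacquetFiltration_holds L v hns χ₁ χ₂ hc1 hc2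
  have hIsm := (F0P3XiUnramNonsplitInstance.isAdmissible_cmPrincipalSeries L v (cmTorusCharPair L v χ₁ χ₂)).isSmooth
  cases h1 with
  | intro hfd hrest =>
  cases hrest with
  | intro h2 hrest' =>
  cases hrest' with
  | intro ℓ hℓ' =>
  -- ONE generic call (master copy = N1's line data; `Equiv.refl` bridges `cmPrincipalSeries … = i_B^G χ` definitionally), then ONE `exact`
  have H := IrrClass.labelledPair_exists_of_line_abs_same hfd h2 ℓ hℓ'.1 hℓ'.2.1 hℓ'.2.2
    (F0P3UnipotentLimitCompactOpen.isLimitOfCompactOpen_cmUnipotentU L v)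
    (F0P2nBorelCharactersUnipotent.deltaChar_cmBorel_eq_one L v) (Representation.Equiv.refl _) hIsm hlen
    (F0P3cStCharTSWeylFixedIffNormTrivial.cmWeylTorusCharPair_eq_of_apply_fixed_eq_one L v χ₁ χ₂ htriv) htwo hemb (Representation.Equiv.refl _)
  exact H

end Summit.HodgeConjecture.HodgeConjecture.Cruxes.H413.F0P3cStCharTSLdsLabelledPair

end
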